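import Summits.QuantumFields.YangMills.Theorems.BalabanUVNodesClusters
import Literature.MathematicalPhysics.QuantumFieldTheory.Balaban1983to89.B16NodeKnitTowerDatum
import Literature.MathematicalPhysics.QuantumFieldTheory.Balaban1983to89.B16NodeKnitRecordPinned8C
import Literature.MathematicalPhysics.QuantumFieldTheory.Balaban1983to89.Node00.Record8Inhabited
import Literature.MathematicalPhysics.QuantumFieldTheory.Balaban1983to89.B16NodeKnitRecord9

/-!
# BalabanUVNodes ∕ N13 at the record — the K2 route stub `YMDAG.UVSplit.S_N13 Rec` ([Balaban1989LargeFieldII] Thm 1 p. 355 + (0.1), Cor. 3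
# pp. 387 ∕ 391; `Dag.B16_main`) for record predicates `Rec`: the stub unfolded, antitone, CLOSED FROM N13's TWO PRODUCTS per record world;
# REFINEMENT-GENERIC closers over NODE 00's Stage-5 record `IsRecordOfRecord₅C` (from the world's 𝐑-leaf + the five Cor.-3 leaves at `D.C`);
# the F-n24T-1 CENSUS at ₅C ∕ ₈C (the universal 𝐑-slot is FALSE there — the closers serve refinements that PIN the 𝐑-carriers); the Stage-₉
# TOWER-DATUM closers BY NAME (Track A, DAG node N13; cluster K2 «FlowBounds»; KNIT-BY-NAME seat `pub-ymgap-dag-n13-a`, g4; count-neutral)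

HONEST FRAMING.  Count-neutral kernel BOOKKEEPING over landed theorems, by name: the route module's stub signature `S_N13 Rec := AtRecord Rec Dag.B16_main`
(`BalabanUVNodesClustersCore`, p416552) is closed MODULO N13's two displayed products — (R) the property of 𝐑 that [Balaban1988Convergent] p. 244 ASSUMES
and [Balaban1989LargeFieldII] Thm 1 PROVES (pp. 356–391 with [Balaban1989LargeFieldI]), read as the world's `rOperation` leaf, and (UV) Cor. 3 = (0.1) ∕ (2.50)
(p. 387 *«This implies the inequality (2.50) [III], hence Corollary 3.»*), read as the run's Cor.-3 slot —, which stay HYPOTHESES in every theorem below.  N13 is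
NOT discharged; nothing of Bałaban's is asserted or re-derived; one finite four-torus programme at fixed `ε`; nothing continuum ∕ ℝ⁴ ∕ OS ∕ mass-gap ∕ Clay.
0 `def`, 0 `sorry`, standard axioms.  Filed `--supports stmt-QuantumFields-19183` (director-ym LINE №12; pub-ymgap dag-lead (W2): the per-node «AT-RECORD»
module is the node's CLOSER OF RECORD for `S_N0x`).

THE NODE.  `Dag.B16_main ℓ := ℓ.b5 → ℓ.b6 → ℓ.b7 → ℓ.b9 → ℓ.b10 → ℓ.b11 → ℓ.b13 → ℓ.rBasicStep → (ℓ.smallCouplings → ℓ.smallFieldInductive) →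
(ℓ.rOperation ∧ ((ℓ.smallCouplings → ℓ.densitiesDescribed) → (ℓ.smallCouplings → ℓ.uvBounds)))` (Dag.lean :253).  The nine antecedents are the in-edges
(N02–N04, N06–N08, N10, N12, small-field); the conclusion is the pair of PRODUCTS.  This seat's Literature-side knits (modules 1–12: `B16NodeKnit`,
`…Record5 ∕ 5C`, `…Socket`, `…RepTower ∕ LF`, `…RecordPinned ∕ 8C`, `…TowerDatum`) supply every closing term used here BY NAME.

WHAT THIS FILE PROVES.
* §1 `s_N13_iff` (the stub unfolded), `s_N13_antitone` (closed under refinement of `Rec` — every later NODE 00 stage and the route's γ-lowered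
  re-letterings inherit it), **`s_N13_of_products`** (`S_N13 Rec` from the two products per record world: the 𝐑-leaf and the Cor.-3 slot — module 5's
  `b16_main_of_rOperation_of_uvSlot`), `s_N13_of_flowBounds` (bookkeeping: the K2 statement carries `S_N13` as its sixth conjunct).
* §2 REFINEMENT-GENERIC CLOSERS over Stage 5: **`s_N13_of_refines₅C_of_leaf_cor3`** — `S_N13 Rec` for EVERY `Rec` refining `IsRecordOfRecord₅C`, from (R) the
  world's 𝐑-leaf at every run and (UV) the five Cor.-3 leaves `B14Cor3.LeafH ∕ U1 ∕ U2 ∕ L1 ∕ L2` at the datum's construction `D.C` with the world's letters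
  `w.γ, w.em, w.ep` (module 9 `b16_main_of_isRecordOfRecord₅C_of_leaf`); instances `s_N13_rec₅C_of_leaf_cor3`, `s_N13_rec₇C_of_leaf_cor3`, `s_N13_rec₈C_of_leaf_cor3`.
* §3 THE F-n24T-1 CENSUS AT THE C-BOUND RECORDS (referee standard A2 ∕ A5, dag-ref-D READ #32, this seat's modules 9 ∕ 11, `Node00.Record8Inhabited`):
  **`not_forall_rOperation_rec₅C`** ∕ `…rec₈C` — ON EVERY FAMILY the universal 𝐑-slot «every ₅C (resp. ₈C) record world has the `rOperation` leaf at every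
  run» is FALSE (a record with EMPTY target spaces is again a record: the Stage-5 ∕ 8 predicates do not pin the 𝐑-carriers `V`); hence §2's closers are
  NOT instantiable at `Rec := ₅C ∕ ₇C ∕ ₈C` through a universal (R) and serve the refinements that PIN `V` along the run's tower (NODE 00 Stage ₉,
  `VOfTower`: `ROpLeaf V ↔` law transport, module 8 §2) — `s_N13_rec₅C_of_leaf_cor3`'s (R) hypothesis is recorded as unsatisfiable (`s_N13_rec₅C_hR_unsat`).
* §4 THE STAGE-₉ TOWER-DATUM CLOSERS BY NAME (module 12 `B16NodeKnitTowerDatum`): **`s_N13_of_towerData`** (`S_N13 Rec` for every `Rec` whose worlds are bound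
  to SOME tower datum `datumOfTower F N M τ` and carry, per run, representation data with the recursion, the Stage-₉ reading, the pin reading of the
  𝐑-leaf, (R₉) and (UV₉)), `s_N13_of_towerSlots` (slot-family currency over `Node00.TexpAOfRecord` ∕ `densityOfRepr` with node00-def-T's recursion
  `texpA (k+1) = Rstep (Tstep (texpA k))`), `s_N13_of_towerSlots_along` ((R₉) along the tower — the form the pinned leaf delivers by `Iff.rfl`).
* §5 (v1.1, plan (W2′) ∕ NODE 00 LOCATED COST 2 «₉C ↛ ₅C at the datum»): `s_N13_of_sameWorld` (the stub is WORLD-READING — it transfers along any same-world map of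
  record pairs, e.g. ₉C → ₅C at the shadow) and the RECORD-FREE closer **`s_N13_of_leaf_cor3World`** (𝐑-leaf + Cor.-3 leaves at the world's own `w.C`; fires at any `Rec`).
* §6 (v1.2, def-T `Node00/Record9` with the 𝐑-carriers PINNED FROM THE TOWER — TS-9 (A)): **`s_N13_rec₉C_of_laws`** ∕ `s_N13_of_refines₉C_of_laws` — `S_N13` at
  `IsRecordOfRecord₉C` (and every refinement) from (R₉) law transport `TLaw₉ → SLaw₉ (k+1)` = the run's 𝐑-leaf ITSELF and (UV₉) (0.1) pointwise on `densOfRecord₉`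
  (module 14 `B16NodeKnitRecord9`) — ★ v1.3 ERRATUM (dag-ref-B READ-280, vacuity audit A2 ∕ A5): BOTH §6 closers are VACUOUS AS TYPED — their hypothesis `slots`
  quantifies over ALL admissible θ with provisos, hence over the residual-swapped sisters (`ScorrLaw ≡ ⊤`, `S218 ≡ ⊥`) of any inhabitant, at which (R₉) fails at
  `k = 0` of every run with `K ≥ 1`: REFUTABLE at every inhabited `N` (kernel: sibling module `BalabanUVNodesN13AtRecord9Keyed` — `not_slots₉C_of_inhabited`; at `N = 1` unconditionally `not_slots₉C_SU1`, via
  `Node00.Record9InhabitedSU1`); the v1.2 clause «§3's census does not bite at ₉C» was WRONG and is withdrawn; located, count-neutral, NOT-A-DISCHARGE.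
  ★ THE READ-280 REPAIR lives in the sibling module `Summits/QuantumFields/YangMills/Theorems/BalabanUVNodesN13AtRecord9Keyed.lean` (v1.3 companion; this file stays
  ≤ 400 lines): `s_N13_of_refines₉C_of_laws_keyed` — `S_N13 Rec` for every `Rec` refining ₉C from law slots KEYED TO THE RECORD'S OWN PARAMETERS (dag-ref-B's SOUND
  SHAPE `∀ F D w, Rec F D w → ∀ θ h, ⟨₉C witness clause of (D, w) at θ⟩ → ∀ P, (R₉) ∧ (UV₉)`), its ₉C instance, and the CENSUS in kernel form (`not_slots₉C_of_inhabited` ∕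
  `_SU1`: §6's universal slot is FALSE given one inhabitant, at `N = 1` outright; `not_keyedSlots_rec₉C_of_inhabited` ∕ `_SU1`: over `Rec := ₉C` ITSELF even the keyed slot
  is FALSE given one inhabitant, so the keyed closer carries content exactly over refinements that PIN the residual laws — ₉⁺ ∕ `Record11` (S), DEDUP №11; vacuity STATED, A5).
Sources: T. Bałaban, CMP **122** (1989) 355–392 [Balaban1989LargeFieldII] Thm 1 p. 355, (0.1) pp. 355–356, p. 387, p. 391; CMP **119** (1988) 243–285
[Balaban1988Convergent] p. 244, (2.18) p. 257, Cor. 3 (2.50) p. 264; CMP **122** (1989) 175–202 [Balaban1989LargeFieldI] (0.2)–(0.4) p. 176.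
-/

noncomputable section

open scoped BigOperators

namespace Summit.QuantumFields.YangMills.BalabanUVNodes.N13AtRecord

open Literature.MathematicalPhysics.QuantumFieldTheory.Balaban1983to89
open Literature.MathematicalPhysics.QuantumFieldTheory.Balaban1983to89.T4Continuum
open Literature.MathematicalPhysics.QuantumFieldTheory.Balaban1983to89.DagBinding
open Literature.MathematicalPhysics.QuantumFieldTheory.Balaban1983to89.Node00
open Literature.MathematicalPhysics.QuantumFieldTheory.Balaban1983to89.T4DatumAssembly (RGMachineCore datumOfTower)
open Literature.MathematicalPhysics.QuantumFieldTheory.Balaban1983to89.FlowStepRuns (genFlow genSeq)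
open Literature.MathematicalPhysics.QuantumFieldTheory.Balaban1983to89.B16NodeKnitRecord5 (b16_main_of_rOperation_of_uvSlot)
open Literature.MathematicalPhysics.QuantumFieldTheory.Balaban1983to89.B16NodeKnitRecordPinned
  (b16_main_of_isRecordOfRecord₅C_of_leaf not_forall_record_rOperation₅C)
open Literature.MathematicalPhysics.QuantumFieldTheory.Balaban1983to89.B16NodeKnitRecordPinned8C
  (b16_main_of_isRecordOfRecord₈C_of_leaf not_forall_record_rOperation₈C)
open Literature.MathematicalPhysics.QuantumFieldTheory.Balaban1983to89.B16NodeKnitTowerDatum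
  (b16_main_at_datumOfTower_repTower b16_main_at_datumOfTower_slots b16_main_at_datumOfTower_slots_along)
open YMDAG.UVSplit (RecordPred Datum AtRecord S_N03 S_N06 S_N09 S_N10 S_N11 S_N13 FlowBounds)

variable {N : ℕ} [NeZero N]

/-! ## §1 The stub unfolded; antitone in `Rec`; CLOSED FROM THE TWO PRODUCTS; its place in K2 -/

/-- **What `S_N13 Rec` says** (`Iff.rfl`): at every run of every binding world of every record pair, GIVEN the in-edge leaves `b5, b6, b7, b9, b10, b11, b13,
rBasicStep` and the small-field implication, the world's 𝐑-leaf holds AND the run's Cor.-3 slot «(interval ⇒ §2 description) ⇒ (interval ⇒ (0.1))» holds.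
[cite: Balaban1989LargeFieldII, Thm 1 p.355 and (0.1) pp.355–356 (the node's content; bookkeeping)] -/
theorem s_N13_iff (Rec : RecordPred N) :
    S_N13 Rec ↔ ∀ (F : T4Family) (D : Datum F N) (w : WorldP), Rec F D w → ∀ P : B12.RunParams,
      (leavesP w P).b5 → (leavesP w P).b6 → (leavesP w P).b7 → (leavesP w P).b9 → (leavesP w P).b10 → (leavesP w P).b11 →
        (leavesP w P).b13 → (leavesP w P).rBasicStep → ((leavesP w P).smallCouplings → (leavesP w P).smallFieldInductive) →
          ((leavesP w P).rOperation ∧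
            (((leavesP w P).smallCouplings → (leavesP w P).densitiesDescribed) →
              ((leavesP w P).smallCouplings → (leavesP w P).uvBounds))) :=
  Iff.rfl

/-- **`S_N13` is ANTITONE in the record predicate**: proved at `Rec`, it holds at every `Rec'` refining `Rec` — every later NODE 00 stage and the route's
γ-lowered re-letterings inherit it. [cite: Balaban1989LargeFieldII, Thm 1 p.355 (bookkeeping)] -/
theorem s_N13_antitone {Rec Rec' : RecordPred N}
    (hle : ∀ (F : T4Family) (D : Datum F N) (w : WorldP), Rec' F D w → Rec F D w) (h : S_N13 Rec) : S_N13 Rec' :=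
  fun F D w hR P => h F D w (hle F D w hR) P

/-- **`S_N13 Rec` FROM N13's TWO PRODUCTS PER RECORD WORLD** (the in-edges are NOT consumed — how every closing term below concludes; no ex-falso route):
(R) the world's 𝐑-leaf at every run ([Balaban1988Convergent] p. 244's assumption = what [Balaban1989LargeFieldII] Thm 1 delivers) and (UV) the run's Cor.-3 slot
((0.1) ∕ (2.50), p. 387).  Module 5's `b16_main_of_rOperation_of_uvSlot`. [cite: Balaban1989LargeFieldII, Thm 1 p.355, (0.1) pp.355–356, p.387, p.391; Balaban1988Convergent, p.244, Cor. 3 p.264] -/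
theorem s_N13_of_products (Rec : RecordPred N)
    (hR : ∀ (F : T4Family) (D : Datum F N) (w : WorldP), Rec F D w → ∀ P : B12.RunParams, (w.up P).rOperation)
    (huv : ∀ (F : T4Family) (D : Datum F N) (w : WorldP), Rec F D w → ∀ P : B12.RunParams,
      ((leavesP w P).smallCouplings → (leavesP w P).densitiesDescribed) →
        ((leavesP w P).smallCouplings → (leavesP w P).uvBounds)) :
    S_N13 Rec :=
  fun F D w h P => b16_main_of_rOperation_of_uvSlot w P (hR F D w h P) (huv F D w h P)

/-- Bookkeeping: the K2 cluster statement `FlowBounds Rec` CARRIES `S_N13 Rec` as its sixth conjunct (and `YMDAG.UVSplit.FlowBounds_of` takes it as its sixth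
argument), so the closers of this file ARE the K2-facing N13 closers modulo the products. [cite: Balaban1989LargeFieldII, Thm 1 p.355 (bookkeeping)] -/
theorem s_N13_of_flowBounds (Rec : RecordPred N) (h : FlowBounds Rec) : S_N13 Rec :=
  fun F D w hR P => (h F D w hR P).2.2.2.2.2

/-! ## §2 REFINEMENT-GENERIC CLOSERS over NODE 00's Stage-5 record `IsRecordOfRecord₅C`: from the 𝐑-leaf and the five Cor.-3 leaves at `D.C` -/

/-- **`S_N13 Rec` FOR EVERY RECORD PREDICATE REFINING ₅C, from the world's 𝐑-leaf and the Cor.-3 leaves at the datum** ([Balaban1989LargeFieldII] Thm 1 + Cor. 3):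
for `Rec F D w → IsRecordOfRecord₅C F N D w` (so `w.C = D.C`: `Node00.construction_eq_of_isRecordOfRecord₅C`), GIVEN per record world (R) the 𝐑-leaf at every run
and (UV) a representation family `R : B14Cor3.ReprFamily D.C` with the five leaves `LeafH ∕ LeafU1 ∕ LeafU2 ∕ LeafL1 ∕ LeafL2` on `]0, w.γ]` with the world's
dependence functions `w.ep ∕ w.em` ([Balaban1988Convergent] Cor. 3 p. 264: (1.72), (2.46), (2.47), (2.49), the lower-bound companion; the cell's Cor.-3 chain
`B16Cor3*` discharges them on torus carriers), `S_N13 Rec` — module 9's `b16_main_of_isRecordOfRecord₅C_of_leaf` BY NAME.  Covers ₅C itself, ₇C ∕ ₈C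
(`Node00.isRecordOfRecord₅C_of_isRecordOfRecord₇C ∕ ₈C`) and the ₉C re-base once its refinement to ₅C is proved — but see §3: at ₅C ∕ ₇C ∕ ₈C themselves the
universal (R) is FALSE. [cite: Balaban1989LargeFieldII, Thm 1 p.355, p.387, p.391; Balaban1988Convergent, p.244, Cor. 3 (2.50) p.264] -/
theorem s_N13_of_refines₅C_of_leaf_cor3 (Rec : RecordPred N)
    (href : ∀ (F : T4Family) (D : Datum F N) (w : WorldP), Rec F D w → IsRecordOfRecord₅C F N D w)
    (hR : ∀ (F : T4Family) (D : Datum F N) (w : WorldP), Rec F D w → ∀ P : B12.RunParams, (w.up P).rOperation)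
    (hcor : ∀ (F : T4Family) (D : Datum F N) (w : WorldP), Rec F D w →
      ∃ R : B14Cor3.ReprFamily D.C, B14Cor3.LeafH D.C R w.γ ∧ B14Cor3.LeafU1 D.C R w.γ ∧ B14Cor3.LeafU2 D.C R w.γ w.ep ∧
        B14Cor3.LeafL1 D.C R w.γ ∧ B14Cor3.LeafL2 D.C R w.γ w.em) :
    S_N13 Rec := by
  intro F D w h P
  obtain ⟨R, hH, hU1, hU2, hL1, hL2⟩ := hcor F D w h
  exact b16_main_of_isRecordOfRecord₅C_of_leaf (href F D w h) (hR F D w h) R hH hU1 hU2 hL1 hL2 P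

/-- **`S_N13` AT THE RECORD PREDICATE OF RECORD ITSELF** (`Rec := IsRecordOfRecord₅C`), from the 𝐑-leaf and the Cor.-3 leaves at the datum.  CAVEAT §3: its (R)
hypothesis `hR` is UNSATISFIABLE (`s_N13_rec₅C_hR_unsat`) — recorded for the shape, not for use; the live instance is the ₉C refinement.
[cite: Balaban1989LargeFieldII, Thm 1 p.355, p.387; Balaban1988Convergent, p.244, Cor. 3 p.264] -/
theorem s_N13_rec₅C_of_leaf_cor3
    (hR : ∀ (F : T4Family) (D : Datum F N) (w : WorldP), IsRecordOfRecord₅C F N D w → ∀ P : B12.RunParams, (w.up P).rOperation)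
    (hcor : ∀ (F : T4Family) (D : Datum F N) (w : WorldP), IsRecordOfRecord₅C F N D w →
      ∃ R : B14Cor3.ReprFamily D.C, B14Cor3.LeafH D.C R w.γ ∧ B14Cor3.LeafU1 D.C R w.γ ∧ B14Cor3.LeafU2 D.C R w.γ w.ep ∧
        B14Cor3.LeafL1 D.C R w.γ ∧ B14Cor3.LeafL2 D.C R w.γ w.em) :
    S_N13 (fun F D w => IsRecordOfRecord₅C F N D w) :=
  s_N13_of_refines₅C_of_leaf_cor3 _ (fun _ _ _ h => h) hR hcor

/-- **`S_N13` AT THE STAGE-7 RECORD** (`Rec := IsRecordOfRecord₇C`; refines ₅C by `Node00.isRecordOfRecord₅C_of_isRecordOfRecord₇C`), from the 𝐑-leaf and the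
Cor.-3 leaves at the datum (same caveat as ₅C: Stage 7 keeps `res.V`). [cite: Balaban1989LargeFieldII, Thm 1 p.355, p.387; Balaban1988Convergent, p.244, Cor. 3 p.264] -/
theorem s_N13_rec₇C_of_leaf_cor3
    (hR : ∀ (F : T4Family) (D : Datum F N) (w : WorldP), IsRecordOfRecord₇C F N D w → ∀ P : B12.RunParams, (w.up P).rOperation)
    (hcor : ∀ (F : T4Family) (D : Datum F N) (w : WorldP), IsRecordOfRecord₇C F N D w →
      ∃ R : B14Cor3.ReprFamily D.C, B14Cor3.LeafH D.C R w.γ ∧ B14Cor3.LeafU1 D.C R w.γ ∧ B14Cor3.LeafU2 D.C R w.γ w.ep ∧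
        B14Cor3.LeafL1 D.C R w.γ ∧ B14Cor3.LeafL2 D.C R w.γ w.em) :
    S_N13 (fun F D w => IsRecordOfRecord₇C F N D w) :=
  s_N13_of_refines₅C_of_leaf_cor3 _ (fun _ _ _ h => isRecordOfRecord₅C_of_isRecordOfRecord₇C h) hR hcor

/-- **`S_N13` AT THE STAGE-8 RECORD** (`Rec := IsRecordOfRecord₈C`; refines ₅C by `Node00.isRecordOfRecord₅C_of_isRecordOfRecord₈C`; the predicate n24-a ∕ n26-a ∕
n28-a type their ₈C modules over), from the 𝐑-leaf and the Cor.-3 leaves at the datum — module 11's `b16_main_of_isRecordOfRecord₈C_of_leaf` BY NAME.  ∀-FORM over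
every ₈C record (hygiene R445 (A)); caveat §3 as for ₅C. [cite: Balaban1989LargeFieldII, Thm 1 p.355, p.387; Balaban1988Convergent, p.244, Cor. 3 p.264] -/
theorem s_N13_rec₈C_of_leaf_cor3
    (hR : ∀ (F : T4Family) (D : Datum F N) (w : WorldP), IsRecordOfRecord₈C F N D w → ∀ P : B12.RunParams, (w.up P).rOperation)
    (hcor : ∀ (F : T4Family) (D : Datum F N) (w : WorldP), IsRecordOfRecord₈C F N D w →
      ∃ R : B14Cor3.ReprFamily D.C, B14Cor3.LeafH D.C R w.γ ∧ B14Cor3.LeafU1 D.C R w.γ ∧ B14Cor3.LeafU2 D.C R w.γ w.ep ∧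
        B14Cor3.LeafL1 D.C R w.γ ∧ B14Cor3.LeafL2 D.C R w.γ w.em) :
    S_N13 (fun F D w => IsRecordOfRecord₈C F N D w) := by
  intro F D w h P
  obtain ⟨R, hH, hU1, hU2, hL1, hL2⟩ := hcor F D w h
  exact b16_main_of_isRecordOfRecord₈C_of_leaf h (hR F D w h) R hH hU1 hU2 hL1 hL2 P

/-! ## §3 THE F-n24T-1 CENSUS at the C-bound records: the universal 𝐑-slot is FALSE at ₅C ∕ ₈C on every family -/

/-- **CENSUS, ₅C (F-n24T-1 class; referee standard A2 ∕ A5)**: ON EVERY FAMILY the universal 𝐑-slot «every Stage-5 (C-bound) record world has the `rOperation` leaf at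
every run» is FALSE — a Stage-8 record exists on every family (`Node00.Record8Inhabited.exists_isRecordOfRecord₈C`, a typing witness, chair R445 (A)), it is a
Stage-5 record, and replacing its 𝐑-carriers by ones with EMPTY target spaces yields again a Stage-5 record whose leaf fails (module 9
`not_forall_record_rOperation₅C`).  So §2's closers are NOT instantiable at `Rec := ₅C` through a universal (R): they serve the refinements that PIN `V`
along the run's tower (NODE 00 Stage ₉). [cite: Balaban1988Convergent, p.244 (bookkeeping census); Balaban1989LargeFieldII, Thm 1 p.355] -/
theorem not_forall_rOperation_rec₅C (F : T4Family) :
    ¬ ∀ (D : Datum F N) (w : WorldP), IsRecordOfRecord₅C F N D w → ∀ P : B12.RunParams, (w.up P).rOperation := by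
  obtain ⟨D, w, h⟩ := Record8Inhabited.exists_isRecordOfRecord₈C F N
  exact not_forall_record_rOperation₅C (isRecordOfRecord₅C_of_isRecordOfRecord₈C h)

/-- **CENSUS, ₈C**: likewise the universal 𝐑-slot over the Stage-8 records is FALSE on every family (module 11 `not_forall_record_rOperation₈C`: Stage 8 keeps
`res.V` free). [cite: Balaban1988Convergent, p.244 (bookkeeping census); Balaban1989LargeFieldII, Thm 1 p.355] -/
theorem not_forall_rOperation_rec₈C (F : T4Family) :
    ¬ ∀ (D : Datum F N) (w : WorldP), IsRecordOfRecord₈C F N D w → ∀ P : B12.RunParams, (w.up P).rOperation := by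
  obtain ⟨D, w, h⟩ := Record8Inhabited.exists_isRecordOfRecord₈C F N
  exact not_forall_record_rOperation₈C h

/-- **The (R) hypothesis of `s_N13_rec₅C_of_leaf_cor3` is UNSATISFIABLE** (it quantifies over all families; the four-torus family of record refutes it) — the
instance is recorded for the shape only; vacuity stated, not hidden (F-n24T-1 ∕ (R-C1) class). [cite: Balaban1988Convergent, p.244 (bookkeeping census)] -/
theorem s_N13_rec₅C_hR_unsat (F : T4Family) :
    ¬ ∀ (F' : T4Family) (D : Datum F' N) (w : WorldP), IsRecordOfRecord₅C F' N D w → ∀ P : B12.RunParams, (w.up P).rOperation :=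
  fun h => not_forall_rOperation_rec₅C (N := N) F (h F)

/-! ## §4 THE STAGE-₉ TOWER-DATUM CLOSERS, BY NAME (module 12 `B16NodeKnitTowerDatum`) -/

/-- **`S_N13 Rec` FOR EVERY `Rec` BOUND TO TOWER DATA** (NODE 00 Stage ₉ shape, pub-ymgap chair R437 ∕ R439): if every `Rec`-world is bound to the tower datum of
SOME machine core `M` and explicit density tower `τ` along the averaging of record (`w.C = (datumOfTower F N M τ).C`) and carries, at every run `P`,
representation data `rep k : Rep k` with the recursion `rep (k+1) = Rstep k (Tstep k (rep k))` ([III] (0.2)), the Stage-₉ reading (`τ.ρ P k = eval rep_k`,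
core clause «form ∧ laws»), the PIN READING of its 𝐑-leaf (law transport along the tower ⇒ `(w.up P).rOperation`), and N13's two products — (R₉) `∀ r,
LawsT k r → Laws (k+1) (Rstep k r)` for `k < K` ([Balaban1989LargeFieldII] Thm 1 for 𝐑 at representation level) and (UV₉) the pointwise (0.1) on `eval rep_k`
at the core's objects for law-abiding levels below `w.γ` (p. 387) —, then `S_N13 Rec`.  `B16NodeKnitTowerDatum.b16_main_at_datumOfTower_repTower` BY NAME.  At
NODE 00's `Record9C` the core, tower, data and pin are the record's, and (R₉) ∕ (UV₉) are what a discharge proves there.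
[cite: Balaban1989LargeFieldII, Thm 1 p.355, (0.1) pp.355–356, p.387, p.391; Balaban1988Convergent, (0.2) and p.244, (2.18) p.257, Cor. 3 p.264] -/
theorem s_N13_of_towerData (Rec : RecordPred N)
    (h : ∀ (F : T4Family) (D : Datum F N) (w : WorldP), Rec F D w →
      ∃ (M : RGMachineCore F (SU N)) (τ : M.Tower (avOfRecord F N)),
        w.C = (datumOfTower F N M τ).C ∧ ∀ P : B12.RunParams,
          ∃ (Rep : ℕ → Type) (rep : (k : ℕ) → Rep k) (Tstep : (k : ℕ) → Rep k → Rep (k + 1))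
            (Rstep : (k : ℕ) → Rep (k + 1) → Rep (k + 1)) (Laws : (k : ℕ) → Rep k → Prop) (LawsT : (k : ℕ) → Rep (k + 1) → Prop)
            (eval : (k : ℕ) → Rep k → Density (F.P P.K) k (SU N)),
          (∀ k, rep (k + 1) = Rstep k (Tstep k (rep k))) ∧
          (∀ k, τ.ρ P k = eval k (rep k)) ∧
          (∀ k, k ≤ P.K → (M.Sect2Form P k ↔ (τ.ρ P k = eval k (rep k) ∧ Laws k (rep k)))) ∧
          ((∀ k, k < P.K → LawsT k (Tstep k (rep k)) → Laws (k + 1) (rep (k + 1))) → (w.up P).rOperation) ∧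
          (∀ k, k < P.K → ∀ r : Rep (k + 1), LawsT k r → Laws (k + 1) (Rstep k r)) ∧
          ((genFlow M.βfun P.g0).InInterval w.γ P.K → ∀ k, k ≤ P.K → Laws k (rep k) → ∀ U : GaugeField (F.P P.K) k (SU N),
            M.χ P k U * Real.exp (-(1 / (genSeq M.βfun P.g0 k) ^ 2 * M.wilsonBG P k U)
                - w.em (genSeq M.βfun P.g0 k) * (Fintype.card (Site (F.P P.K) k) : ℝ)) ≤ eval k (rep k) U ∧
            eval k (rep k) U ≤ Real.exp (w.ep (genSeq M.βfun P.g0 k) * (Fintype.card (Site (F.P P.K) k) : ℝ)))) :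
    S_N13 Rec := by
  intro F D w hw P
  obtain ⟨M, τ, hC, hP⟩ := h F D w hw
  obtain ⟨Rep, rep, Tstep, Rstep, Laws, LawsT, eval, hsucc, hρ, hS9, hRpin, hR9, hUV9⟩ := hP P
  exact b16_main_at_datumOfTower_repTower F N M τ w P rep Tstep Rstep Laws LawsT eval hC hsucc hρ hS9 hRpin hR9 le_rfl hUV9

/-- **`S_N13 Rec` OVER THE SLOT FAMILY OF THE (2.18) REPRESENTATION OF RECORD** (NODE 00 Stage ₉: node00-def-R's `Node00.TexpAOfRecord` ∕ `densityOfRepr`, node00-def-T's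
recursion `texpA P g (k+1) = Rstep k (Tstep k (texpA P g k))` — `slotsOfRecord_succ` ∕ `texpAOfRecord_succ`, `rfl`): if every `Rec`-world is bound to a tower datum whose
densities are the ASSEMBLED ones `τ.ρ P k = densityOfRepr … texpA P g k` of a slot family obeying the recursion, with the Stage-₉ reading, the pin reading, (R₉) ON
SLOTS `∀ f, LawsT k f → Laws (k+1) (Rstep k f)` and (UV₉) on the assembled densities below `w.γ`, then `S_N13 Rec`.  `B16NodeKnitTowerDatum.b16_main_at_datumOfTower_slots`
BY NAME. [cite: Balaban1989LargeFieldII, Thm 1 p.355, (0.1) pp.355–356, p.387, p.391; Balaban1988Convergent, (2.18) p.257, (3.24)–(3.25) p.270, p.244; Balaban1989LargeFieldI, (0.3) p.176] -/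
theorem s_N13_of_towerSlots (Rec : RecordPred N)
    (h : ∀ (F : T4Family) (D : Datum F N) (w : WorldP), Rec F D w →
      ∃ (M : RGMachineCore F (SU N)) (τ : M.Tower (avOfRecord F N)) (ν : Stage7Numerics) (Mx : ℕ) (texpA : TexpAOfRecord F N ν Mx),
        w.C = (datumOfTower F N M τ).C ∧ ∀ P : B12.RunParams, ∃ (g : ℕ → ℝ)
          (Tstep : (k : ℕ) → (SeqOfRecord F ν Mx g P.K k → Density (F.P P.K) k (SU N)) →
            (SeqOfRecord F ν Mx g P.K (k + 1) → Density (F.P P.K) (k + 1) (SU N)))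
          (Rstep : (k : ℕ) → (SeqOfRecord F ν Mx g P.K (k + 1) → Density (F.P P.K) (k + 1) (SU N)) →
            (SeqOfRecord F ν Mx g P.K (k + 1) → Density (F.P P.K) (k + 1) (SU N)))
          (Laws : (k : ℕ) → (SeqOfRecord F ν Mx g P.K k → Density (F.P P.K) k (SU N)) → Prop)
          (LawsT : (k : ℕ) → (SeqOfRecord F ν Mx g P.K (k + 1) → Density (F.P P.K) (k + 1) (SU N)) → Prop),
          (∀ k, texpA P g (k + 1) = Rstep k (Tstep k (texpA P g k))) ∧
          (∀ k, τ.ρ P k = densityOfRepr F N ν Mx texpA P g k) ∧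
          (∀ k, k ≤ P.K → (M.Sect2Form P k ↔ (τ.ρ P k = densityOfRepr F N ν Mx texpA P g k ∧ Laws k (texpA P g k)))) ∧
          ((∀ k, k < P.K → LawsT k (Tstep k (texpA P g k)) → Laws (k + 1) (texpA P g (k + 1))) → (w.up P).rOperation) ∧
          (∀ k, k < P.K → ∀ f : SeqOfRecord F ν Mx g P.K (k + 1) → Density (F.P P.K) (k + 1) (SU N),
            LawsT k f → Laws (k + 1) (Rstep k f)) ∧
          ((genFlow M.βfun P.g0).InInterval w.γ P.K → ∀ k, k ≤ P.K → Laws k (texpA P g k) → ∀ U : GaugeField (F.P P.K) k (SU N),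
            M.χ P k U * Real.exp (-(1 / (genSeq M.βfun P.g0 k) ^ 2 * M.wilsonBG P k U)
                - w.em (genSeq M.βfun P.g0 k) * (Fintype.card (Site (F.P P.K) k) : ℝ)) ≤ densityOfRepr F N ν Mx texpA P g k U ∧
            densityOfRepr F N ν Mx texpA P g k U ≤ Real.exp (w.ep (genSeq M.βfun P.g0 k) * (Fintype.card (Site (F.P P.K) k) : ℝ)))) :
    S_N13 Rec := by
  intro F D w hw P
  obtain ⟨M, τ, ν, Mx, texpA, hC, hP⟩ := h F D w hw
  obtain ⟨g, Tstep, Rstep, Laws, LawsT, hsucc, hρ, hS9, hRpin, hR9, hUV9⟩ := hP P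
  exact b16_main_at_datumOfTower_slots F N M τ w P ν Mx g texpA Tstep Rstep Laws LawsT hC hsucc hρ hS9 hRpin hR9 le_rfl hUV9

/-- **`S_N13 Rec` over the slot family with (R₉) READ ALONG THE TOWER** (`LawsT k (Tstep k (texpA P g k)) → Laws (k+1) (texpA P g (k+1))`, no `Rstep` named) — the
form NODE 00's 𝐑-leaf pinned along the run's tower delivers by `Iff.rfl` (`VOfTower`, module 8 §2); `B16NodeKnitTowerDatum.b16_main_at_datumOfTower_slots_along` BY NAME.
[cite: Balaban1989LargeFieldII, Thm 1 p.355, (0.1) pp.355–356, p.387, p.391; Balaban1988Convergent, (2.18) p.257, p.244] -/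
theorem s_N13_of_towerSlots_along (Rec : RecordPred N)
    (h : ∀ (F : T4Family) (D : Datum F N) (w : WorldP), Rec F D w →
      ∃ (M : RGMachineCore F (SU N)) (τ : M.Tower (avOfRecord F N)) (ν : Stage7Numerics) (Mx : ℕ) (texpA : TexpAOfRecord F N ν Mx),
        w.C = (datumOfTower F N M τ).C ∧ ∀ P : B12.RunParams, ∃ (g : ℕ → ℝ)
          (Tstep : (k : ℕ) → (SeqOfRecord F ν Mx g P.K k → Density (F.P P.K) k (SU N)) →
            (SeqOfRecord F ν Mx g P.K (k + 1) → Density (F.P P.K) (k + 1) (SU N)))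
          (Laws : (k : ℕ) → (SeqOfRecord F ν Mx g P.K k → Density (F.P P.K) k (SU N)) → Prop)
          (LawsT : (k : ℕ) → (SeqOfRecord F ν Mx g P.K (k + 1) → Density (F.P P.K) (k + 1) (SU N)) → Prop),
          (∀ k, τ.ρ P k = densityOfRepr F N ν Mx texpA P g k) ∧
          (∀ k, k ≤ P.K → (M.Sect2Form P k ↔ (τ.ρ P k = densityOfRepr F N ν Mx texpA P g k ∧ Laws k (texpA P g k)))) ∧
          ((∀ k, k < P.K → LawsT k (Tstep k (texpA P g k)) → Laws (k + 1) (texpA P g (k + 1))) → (w.up P).rOperation) ∧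
          (∀ k, k < P.K → LawsT k (Tstep k (texpA P g k)) → Laws (k + 1) (texpA P g (k + 1))) ∧
          ((genFlow M.βfun P.g0).InInterval w.γ P.K → ∀ k, k ≤ P.K → Laws k (texpA P g k) → ∀ U : GaugeField (F.P P.K) k (SU N),
            M.χ P k U * Real.exp (-(1 / (genSeq M.βfun P.g0 k) ^ 2 * M.wilsonBG P k U)
                - w.em (genSeq M.βfun P.g0 k) * (Fintype.card (Site (F.P P.K) k) : ℝ)) ≤ densityOfRepr F N ν Mx texpA P g k U ∧
            densityOfRepr F N ν Mx texpA P g k U ≤ Real.exp (w.ep (genSeq M.βfun P.g0 k) * (Fintype.card (Site (F.P P.K) k) : ℝ)))) :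
    S_N13 Rec := by
  intro F D w hw P
  obtain ⟨M, τ, ν, Mx, texpA, hC, hP⟩ := h F D w hw
  obtain ⟨g, Tstep, Laws, LawsT, hρ, hS9, hRpin, hRalong, hUV9⟩ := hP P
  exact b16_main_at_datumOfTower_slots_along F N M τ w P ν Mx g texpA Tstep Laws LawsT hC hρ hS9 hRpin hRalong le_rfl hUV9


/-! ## §5 (v1.1, plan (W2′) l.10686 ∕ def-T LOCATED COST 2) N13's stub is WORLD-READING: transfer along same-world record maps; a RECORD-FREE closer -/

/-- **`S_N13` TRANSFERS ALONG ANY SAME-WORLD MAP OF RECORD PAIRS** (plan (W2′)(i): «world-reading faces are free via `atWorld_of_isRecordOfRecord₉C`»): the node statement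
`Dag.B16_main (leavesP w P)` reads the binding WORLD only (`w.C`, `w.up`, `w.γ`, `w.em`, `w.ep`), never the datum `D`; so if every `Rec`-pair `(D, w)` has SOME `Rec₅`-pair
`(D₅, w)` with the SAME world (NODE 00's `exists_isRecordOfRecord₅C_of_isRecordOfRecord₉C`: ₉C → ₅C at the SHADOW datum, same world), `S_N13 Rec₅` yields `S_N13 Rec`.
(At `Rec₅ := ₅C` the premise `S_N13 Rec₅` is itself unsatisfiable through a universal (R) — §3 —; the lemma is the bookkeeping of the transfer, not a route to close ₉C.)
[cite: Balaban1989LargeFieldII, Thm 1 p.355 (bookkeeping)] -/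
theorem s_N13_of_sameWorld {Rec Rec₅ : RecordPred N}
    (h : ∀ (F : T4Family) (D : Datum F N) (w : WorldP), Rec F D w → ∃ D₅ : Datum F N, Rec₅ F D₅ w) (h₅ : S_N13 Rec₅) : S_N13 Rec := by
  intro F D w hR P
  obtain ⟨D₅, h5⟩ := h F D w hR
  exact h₅ F D₅ w h5 P

/-- **RECORD-FREE CLOSER — `S_N13 Rec` from the world's 𝐑-leaf and the five Cor.-3 leaves AT THE WORLD'S OWN CONSTRUCTION `w.C`** (fires at ANY `Rec`: ₅C ∕ ₈C ∕ ₉C ∕ the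
V-pinning successor, no refinement to ₅C and no shadow needed — plan (W2′)(ii) for N13): (R) `(w.up P).rOperation` at every run ([Balaban1988Convergent] p. 244 =
[Balaban1989LargeFieldII] Thm 1's delivery) and (UV) a representation family `R : B14Cor3.ReprFamily w.C` with `LeafH ∕ LeafU1 ∕ LeafU2 ∕ LeafL1 ∕ LeafL2` on `]0, w.γ]` with the
world's `w.ep ∕ w.em` ([Balaban1988Convergent] Cor. 3 p. 264: (1.72), (2.46), (2.47), (2.49) + lower companion) — module 1's `B16NodeKnit.uvSlot_of_cor3Leaves` BY NAME.
[cite: Balaban1989LargeFieldII, Thm 1 p.355, p.387, p.391; Balaban1988Convergent, p.244, Cor. 3 (2.50) p.264] -/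
theorem s_N13_of_leaf_cor3World (Rec : RecordPred N)
    (hR : ∀ (F : T4Family) (D : Datum F N) (w : WorldP), Rec F D w → ∀ P : B12.RunParams, (w.up P).rOperation)
    (hcor : ∀ (F : T4Family) (D : Datum F N) (w : WorldP), Rec F D w →
      ∃ R : B14Cor3.ReprFamily w.C, B14Cor3.LeafH w.C R w.γ ∧ B14Cor3.LeafU1 w.C R w.γ ∧ B14Cor3.LeafU2 w.C R w.γ w.ep ∧
        B14Cor3.LeafL1 w.C R w.γ ∧ B14Cor3.LeafL2 w.C R w.γ w.em) :
    S_N13 Rec := by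
  intro F D w h P
  obtain ⟨R, hH, hU1, hU2, hL1, hL2⟩ := hcor F D w h
  exact b16_main_of_rOperation_of_uvSlot w P (hR F D w h P) (B16NodeKnit.uvSlot_of_cor3Leaves w R hH hU1 hU2 hL1 hL2 P)


/-! ## §6 (v1.2) `S_N13` AT NODE 00's STAGE-9 RECORD `IsRecordOfRecord₉C` (def-T `Node00/Record9`; the 𝐑-carriers PINNED FROM THE TOWER, TS-9 (A)) -/

/-- **`S_N13` AT THE STAGE-9 RECORD from N13's two products AT THE OBJECTS OF RECORD** — module 14's `B16NodeKnitRecord9.b16_main_forall_isRecordOfRecord₉C` BY NAME,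
per family: for every admissible `θ : Stage9Params F N` with provisos `h` and every world bound to `datumOfRecord₉ F N θ h` over the Stage-9 view, (R₉) law
transport by 𝐑 along the tower `∀ k < P.K, TLaw₉ … k → SLaw₉ … (k+1)` ([Balaban1989LargeFieldII] Thm 1 at the objects of record — the run's 𝐑-LEAF ITSELF at ₉C,
`rOperation_iff_laws₉`, no pin hypothesis) and (UV₉) (0.1) POINTWISE on `densOfRecord₉ … k` for §2-format levels below `w.γ` (p. 387).  ★ v1.3 ERRATUM (dag-ref-B
READ-280, vacuity audit A2 ∕ A5; the kernel theorem is UNCHANGED): **VACUOUS AS TYPED over ₉C** — `slots` quantifies over ALL admissible θ with provisos, hence over the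
residual-swapped sisters (`ScorrLaw ≡ ⊤`, `S218 ≡ ⊥`) of any inhabitant (`Stage9Params.Admissible` ∕ `.Provisos` constrain no residual law), at which (R₉) fails at `k = 0` of
every run with `K ≥ 1`; so `slots` is REFUTABLE by residual swap at every inhabited `N` (sibling `BalabanUVNodesN13AtRecord9Keyed`: `not_slots₉C_of_inhabited`; at `N = 1` unconditionally, `not_slots₉C_SU1`) and this
closer carries NO content over ₉C; located, count-neutral; NOT-A-DISCHARGE.  The v1.2 sentence printed here — «§3's census does NOT bite here: `VOfRecord₉` is read off the
tower, so the (R) slot is satisfiable exactly when the residual laws `ScorrLaw`∕`S218` make it so» — was WRONG and is withdrawn: §3's census DOES bite, through the residual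
LAWS instead of `res.V`.  The θ-KEYED repair is the sibling's `N13AtRecord9Keyed.s_N13_of_refines₉C_of_laws_keyed` (content over refinements that pin the laws: ₉⁺ ∕ `Record11` (S)).
[cite: Balaban1989LargeFieldII, Thm 1 p.355, (0.1) pp.355–356, p.387, p.391; Balaban1988Convergent, p.244, Cor. 3 (2.50) p.264] -/
theorem s_N13_rec₉C_of_laws
    (slots : ∀ (F : T4Family) (θ : Stage9Params F N) (h : θ.Provisos), θ.Admissible → ∀ w : WorldP, w.C = (datumOfRecord₉ F N θ h).C →
      (∀ P, w.up P = upOfRecord₅C F N (θ.toStage5 F N) P) → ∀ P : B12.RunParams,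
        (∀ k, k < P.K → TLaw₉ F N θ P k → SLaw₉ F N θ P (k + 1)) ∧
        ((genFlow (betaOfRecord₉ F N θ) P.g0).InInterval w.γ P.K → ∀ k, k ≤ P.K → SLaw₉ F N θ P k →
          ∀ U : GaugeField (F.P P.K) k (SU N),
            chiOfRecord F N θ.ν (gOfRecord₉ F N θ P) P.K k U *
                  Real.exp (-(1 / (gOfRecord₉ F N θ P k) ^ 2 * wilsonBGOfRecord F N θ.εbg P k U)
                    - w.em (gOfRecord₉ F N θ P k) * (Fintype.card (Site (F.P P.K) k) : ℝ)) ≤ densOfRecord₉ F N θ P k U ∧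
            densOfRecord₉ F N θ P k U ≤ Real.exp (w.ep (gOfRecord₉ F N θ P k) * (Fintype.card (Site (F.P P.K) k) : ℝ)))) :
    S_N13 (fun F D w => IsRecordOfRecord₉C F N D w) :=
  fun F D w hR P => B16NodeKnitRecord9.b16_main_forall_isRecordOfRecord₉C (slots F) D w hR P

/-- **`S_N13 Rec` FOR EVERY `Rec` REFINING THE STAGE-9 RECORD** (same datum AND world — e.g. the successor records ₉⁺ ∕ ₁₀C that pin `S218`∕`ScorrLaw` and the other carrier
groups), from the same per-parameter products; `s_N13_antitone`.  ★ v1.3 ERRATUM (dag-ref-B READ-280): VACUOUS AS TYPED for EVERY `Rec` — `slots` is §6's universal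
hypothesis over the UNPINNED stage, which the refinement `href` does not restrict (refutable at every inhabited `N`, sibling `BalabanUVNodesN13AtRecord9Keyed.not_slots₉C_of_inhabited`); it therefore
cannot serve ₉⁺ ∕ ₁₀C either.  Use the sibling's `s_N13_of_refines₉C_of_laws_keyed`, whose law slots are keyed to the `Rec`-records' own parameters. [cite: Balaban1989LargeFieldII, Thm 1 p.355, (0.1) pp.355–356, p.387, p.391] -/
theorem s_N13_of_refines₉C_of_laws (Rec : RecordPred N)
    (href : ∀ (F : T4Family) (D : Datum F N) (w : WorldP), Rec F D w → IsRecordOfRecord₉C F N D w)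
    (slots : ∀ (F : T4Family) (θ : Stage9Params F N) (h : θ.Provisos), θ.Admissible → ∀ w : WorldP, w.C = (datumOfRecord₉ F N θ h).C →
      (∀ P, w.up P = upOfRecord₅C F N (θ.toStage5 F N) P) → ∀ P : B12.RunParams,
        (∀ k, k < P.K → TLaw₉ F N θ P k → SLaw₉ F N θ P (k + 1)) ∧
        ((genFlow (betaOfRecord₉ F N θ) P.g0).InInterval w.γ P.K → ∀ k, k ≤ P.K → SLaw₉ F N θ P k →
          ∀ U : GaugeField (F.P P.K) k (SU N),
            chiOfRecord F N θ.ν (gOfRecord₉ F N θ P) P.K k U *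
                  Real.exp (-(1 / (gOfRecord₉ F N θ P k) ^ 2 * wilsonBGOfRecord F N θ.εbg P k U)
                    - w.em (gOfRecord₉ F N θ P k) * (Fintype.card (Site (F.P P.K) k) : ℝ)) ≤ densOfRecord₉ F N θ P k U ∧
            densOfRecord₉ F N θ P k U ≤ Real.exp (w.ep (gOfRecord₉ F N θ P k) * (Fintype.card (Site (F.P P.K) k) : ℝ)))) :
    S_N13 Rec :=
  s_N13_antitone href (s_N13_rec₉C_of_laws slots)

end Summit.QuantumFields.YangMills.BalabanUVNodes.N13AtRecord

end
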